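import Mathlib
import HarnessLib

/-!
# RootDecompChiralSerrin — crux G `DegenerateTransferExtends` (stmt-NavierStokesRegularity-30122), stub `stub_sqrtBarrier`

Registered stub (writer g10 first-prover skeleton, 2026-08-30; lens-1 g6 «CHIRAL SERRIN LADDER», the barrier step of G),
PROVED here verbatim: a continuous nonnegative `H` on `[t₁, T)` with
`H(t)² ≤ H(t₁)² + ∫_{t₁}^{t} κ Φ(s) (a H(s) − ν) ds` (`κ, Φ ≥ 0`, `a ≥ 0`) and the strict initial margin
`a H(t₁) < ν` never exceeds `H(t₁)` — a square-root barrier / continuous induction: as long as `H ≤ H(t₁)` the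
integrand is nonpositive, and the strict margin re-opens a neighbourhood to the right by continuity.

Proof: real induction (`IsClosed.Icc_subset_of_forall_mem_nhdsWithin`) on `s = {x | ∀ u ∈ [t₁, x], H u ≤ H t₁}`
over every `[t₁, T']`, `T' < T`; closedness of `s ∩ [t₁, T']` from the continuity of `H`; the right-neighbourhood
step from `ContinuousWithinAt.preimage_mem_nhdsWithin` and `setIntegral_nonpos`. Elementary; no PDE.
Decoration toward S; Navier–Stokes regularity is NOT proved by anything here (rung 0).
-/

-- the summit and its single sub-problem share the name (CONVENTIONS §1), as in every Theorems file
set_option linter.dupNamespace false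

open MeasureTheory Set Filter Topology

namespace Summit.NavierStokesRegularity.NavierStokesRegularity.Theorems.DegenerateTransferExtends

/-- **Registered stub `stub_sqrtBarrier`** of crux `DegenerateTransferExtends` (stmt-NavierStokesRegularity-30122),
verbatim: the square-root barrier (continuous induction). [folklore] -/
theorem stub_sqrtBarrier : ∀ (t₁ T ν a κ : ℝ) (H Φ : ℝ → ℝ), 0 < ν → 0 ≤ a → 0 ≤ κ → ContinuousOn H (Set.Ico t₁ T) → (∀ t ∈ Set.Ico t₁ T, 0 ≤ H t) → (∀ t ∈ Set.Ico t₁ T, 0 ≤ Φ t) → (∀ t ∈ Set.Ico t₁ T, IntervalIntegrable Φ volume t₁ t ∧ H t ^ 2 ≤ H t₁ ^ 2 + ∫ s in t₁..t, κ * Φ s * (a * H s - ν)) → a * H t₁ < ν → ∀ t ∈ Set.Ico t₁ T, H t ≤ H t₁ := by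
  intro t₁ T ν a κ H Φ hν ha hκ hcont hH hΦ hineq hmargin t ht
  -- the history set
  set s : Set ℝ := {x | ∀ u ∈ Icc t₁ x, H u ≤ H t₁} with hs
  have ht₁s : t₁ ∈ s := fun u hu => by
    rw [le_antisymm hu.2 hu.1]
  -- it suffices to run the induction on `[t₁, t]`
  suffices hsub : Icc t₁ t ⊆ s from hsub ⟨ht.1, le_rfl⟩ t ⟨ht.1, le_rfl⟩
  have htT : t < T := ht.2
  have hIccT : Icc t₁ t ⊆ Ico t₁ T := fun u hu => ⟨hu.1, hu.2.trans_lt htT⟩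
  have hcontI : ContinuousOn H (Icc t₁ t) := hcont.mono hIccT
  -- closedness of `s ∩ [t₁, t]`
  have hclosed : IsClosed (s ∩ Icc t₁ t) := by
    refine isClosed_of_closure_subset fun x hx => ?_
    have hxI : x ∈ Icc t₁ t := closure_minimal inter_subset_right isClosed_Icc hx
    refine ⟨fun u hu => ?_, hxI⟩
    rcases hu.2.lt_or_eq with hlt | heq
    · -- `u < x`: some point of `s ∩ Icc` lies to the right of `u`
      obtain ⟨z, hz, hdist⟩ := Metric.mem_closure_iff.1 hx (x - u) (by linarith)
      have hzu : u ≤ z := by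
        rw [Real.dist_eq] at hdist
        have := (abs_lt.1 hdist).2
        linarith
      exact hz.1 u ⟨hu.1, hzu⟩
    · -- `u = x`: continuity
      subst heq
      have hcw : ContinuousWithinAt H (s ∩ Icc t₁ t) u := (hcontI u hxI).mono inter_subset_right
      have hmem := hcw.mem_closure_image hx
      have himg : H '' (s ∩ Icc t₁ t) ⊆ Iic (H t₁) := by
        rintro _ ⟨z, hz, rfl⟩
        exact hz.1 z ⟨hz.2.1, le_rfl⟩
      exact closure_minimal himg isClosed_Iic hmem
  -- the step to the right
  refine hclosed.Icc_subset_of_forall_mem_nhdsWithin ht₁s fun x hx => ?_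
  obtain ⟨hxs, hxI⟩ := hx
  have hxT : x ∈ Ico t₁ T := ⟨hxI.1, hxI.2.trans htT⟩
  -- strict margin at `x`, re-opened by continuity
  have hHx : a * H x < ν := lt_of_le_of_lt (mul_le_mul_of_nonneg_left (hxs x ⟨hxI.1, le_rfl⟩) ha) hmargin
  have hopen : IsOpen ((fun v : ℝ => a * v) ⁻¹' Iio ν) := isOpen_Iio.preimage (continuous_const.mul continuous_id)
  have hnhds : {y | a * H y < ν} ∈ 𝓝[Ico t₁ T] x :=
    (hcont x hxT).preimage_mem_nhdsWithin (hopen.mem_nhds (by simpa using hHx))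
  obtain ⟨ε, hε, hball⟩ := Metric.mem_nhdsWithin_iff.1 hnhds
  -- every `y ∈ (x, min (x + ε) t]`... we show `Ioo x (min (x + ε) t) ⊆ s`... and use `t < T`
  have hgood : ∀ y, x < y → y < x + ε → y < T → a * H y < ν := by
    intro y hxy hyε hyT
    have hy : y ∈ Metric.ball x ε ∩ Ico t₁ T :=
      ⟨by rw [Metric.mem_ball, Real.dist_eq, abs_lt]; constructor <;> linarith, ⟨hxI.1.trans hxy.le, hyT⟩⟩
    exact hball hy
  refine mem_nhdsGT_iff_exists_Ioo_subset.2 ⟨min (x + ε) T, lt_min (by linarith) hxT.2, fun y hy => ?_⟩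
  have hyε : y < x + ε := hy.2.trans_le (min_le_left _ _)
  have hyT : y < T := hy.2.trans_le (min_le_right _ _)
  -- for every `u ∈ (x, y]`, the integrand is nonpositive on `[t₁, u]`, hence `H u ≤ H t₁`
  intro u hu
  rcases le_or_gt u x with hux | hux
  · exact hxs u ⟨hu.1, hux⟩
  · have huT : u ∈ Ico t₁ T := ⟨hu.1, hu.2.trans_lt hyT⟩
    have hint : ∫ s' in t₁..u, κ * Φ s' * (a * H s' - ν) ≤ 0 := by
      rw [intervalIntegral.integral_of_le hu.1]
      refine setIntegral_nonpos measurableSet_Ioc fun s' hs' => ?_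
      have hs'T : s' ∈ Ico t₁ T := ⟨hs'.1.le, hs'.2.trans_lt huT.2⟩
      have hneg : a * H s' - ν ≤ 0 := by
        rcases le_or_gt s' x with hsx | hsx
        · have := mul_le_mul_of_nonneg_left (hxs s' ⟨hs'.1.le, hsx⟩) ha
          linarith
        · have := hgood s' hsx (by linarith [hs'.2, hu.2]) hs'T.2
          linarith
      exact mul_nonpos_iff.2 (Or.inl ⟨mul_nonneg hκ (hΦ s' hs'T), hneg⟩)
    have hsq : H u ^ 2 ≤ H t₁ ^ 2 := by linarith [(hineq u huT).2]
    have ht₁T : t₁ ∈ Ico t₁ T := ⟨le_rfl, hu.1.trans_lt huT.2⟩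
    exact (pow_le_pow_iff_left₀ (hH u huT) (hH t₁ ht₁T) two_ne_zero).1 hsq

end Summit.NavierStokesRegularity.NavierStokesRegularity.Theorems.DegenerateTransferExtends
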